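import Literature.Combinatorics.LorentzianPolynomials.HodgeRiemann
import HarnessLib

/-!
# Lorentzian polynomials are strongly and completely log-concave: the Hessian inequalities of Brändén–Huh's Thm. 2.30
# ((3) ⟹ (1), (2)) and Prop. 2.33

Layer `Literature/Combinatorics/LorentzianPolynomials`, namespace `Literature.Combinatorics.LorentzianPolynomials`;
lane `lit-hodgefound` (Track 2 foundations library), seat p16, generation 28 (row g28-#12). Brändén–Huh's Theorem 2.30
identifies, for homogeneous polynomials, Gurvits' strongly log-concave polynomials ("`∂^α f` is identically zero or
`log(∂^α f)` is concave on `ℝ^n_{>0}`"), the completely log-concave polynomials of Anari–Oveis Gharan–Vinzant ("`(Π_i D_i) f`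
is identically zero or `log((Π_i D_i) f)` is concave on `ℝ^n_{>0}`", `D_i = Σ_j a_{ij} ∂_j`, `a_{ij} ≥ 0`) and the Lorentzian
polynomials. This file proves the implications FROM Lorentzian, in the concrete form in which they are used — the
Hessian inequalities of Proposition 2.33 at every point `w` of the closed orthant: for `f` homogeneous of degree `d ≥ 2`
with nonnegative coefficients whose Hessian `H_f(w)` has at most one positive eigenvalue (which holds for `f ∈ L^d_n` and
`w ∈ ℝ^n_{≥0}` by Thm. 2.16 (2), `HodgeRiemann.lean`), Euler's formulas `H_f(w) w = (d-1) ∇f(w)`,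
`wᵀ H_f(w) w = d(d-1) f(w)` and the reverse Cauchy–Schwarz inequality of a form with at most one positive square
(`mul_le_sq_of_sigPos_le_one`) give
`f(w) · xᵀ H_f(w) x ≤ (1 - 1/d) (∇f(w)·x)²` for all `x` — the negative semidefiniteness of the Hessian of `f^{1/d}`
(Prop. 2.33 (3) ⟹ (1)), whence `f(w) · xᵀ H_f(w) x ≤ (∇f(w)·x)²`, that of `log f` ((3) ⟹ (2)). Applied to `∂^α f ∈ L`
(Def. 2.6) and to `D_{a_1} ⋯ D_{a_m} f ∈ L` (Cor. 2.11, `foldr_dirDeriv_mem_lorentzian`) these are the Hessian forms of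
"Lorentzian ⟹ strongly log-concave" and "Lorentzian ⟹ completely log-concave" (Thm. 2.30 (3) ⟹ (2), (3) ⟹ (1)). The
converse implications and the passage from Hessian inequalities to concavity of `log`/`(·)^{1/d}` as real functions are
not treated here. -- TODO(general form): Thm. 2.30 (1) ⟹ (3), (2) ⟹ (3).

## Source (verbatim) — P. Brändén, J. Huh, *Lorentzian polynomials* [BrandenHuh2019] (held `paper:arxiv-1902.03719`)

§2.5: "In [Gur09], Gurvits defines `f` to be strongly log-concave if, for all `α ∈ ℕ^n`, `∂^α f` is identically zero or
`log(∂^α f)` is concave on `ℝ^n_{>0}`. In [AOV18], Anari et al. define `f` to be completely log-concave if, for all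
`m ∈ ℕ` and any `m × n` matrix `(a_{ij})` with nonnegative entries, `(Π_{i=1}^m D_i) f` is identically zero or
`log((Π_{i=1}^m D_i) f)` is concave on `ℝ^n_{>0}`, where `D_i` is the differential operator `Σ_{j=1}^n a_{ij} ∂_j`. […]
**Theorem 2.30.** The following conditions are equivalent for any homogeneous polynomial `f`. (1) `f` is completely
log-concave. (2) `f` is strongly log-concave. (3) `f` is Lorentzian. […] Let `f` be a homogeneous polynomial in `n ≥ 2`
variables of degree `d ≥ 2`. **Proposition 2.33.** The following are equivalent for any `w ∈ ℝ^n` satisfying `f(w) > 0`.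
(1) The Hessian of `f^{1/d}` is negative semidefinite at `w`. (2) The Hessian of `log f` is negative semidefinite at `w`.
(3) The Hessian of `f` has exactly one positive eigenvalue at `w`."

## What is here (`f : MvPolynomial σ ℝ`, `H = hessianAt f w`, `∇f(w)·x = Σ_i x_i ∂_i f(w)`)

* `toBilin'_hessianAt_right_self` (Euler: `xᵀ H w = (d-1) ∇f(w)·x`);
* **`eval_mul_toBilin'_hessianAt_le`** (Prop. 2.33 (3) ⟹ (1), pointwise: `f(w) xᵀHx ≤ (1 - 1/d)(∇f(w)·x)²` when
  `sigPos H ≤ 1`), `eval_mul_toBilin'_hessianAt_le'` ((3) ⟹ (2): `≤ (∇f(w)·x)²`);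
* for `f ∈ L^d_n`, `w ∈ ℝ^n_{≥0}`: **`eval_mul_toBilin'_hessianAt_le_of_mem_lorentzian`** (`f^{1/d}`-form),
  `logConcave_of_mem_lorentzian` (`log`-form), **`stronglyLogConcave_of_mem_lorentzian`** (the same for every `∂^α f`,
  Thm. 2.30 (3) ⟹ (2)) and **`completelyLogConcave_of_mem_lorentzian`** (for every `D_{a_1} ⋯ D_{a_m} f`, `a_i ≥ 0`,
  Thm. 2.30 (3) ⟹ (1)).

Theorems only; no definition, no `sorry`, no named fact (net debt 0).

## References

* [BrandenHuh2019] P. Brändén, J. Huh, *Lorentzian polynomials*, Ann. of Math. (2) 192 (2020) 821–891, arXiv:1902.03719 —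
  §2.5 Thm. 2.30, Prop. 2.33 (and its proof via Euler's formula and Cauchy's interlacing theorem); §2.3 Thm. 2.16 (2).
-/

noncomputable section

open MvPolynomial Finsupp Finset
open Literature.LinearAlgebra.QuadraticForm

namespace Literature.Combinatorics.LorentzianPolynomials

variable {σ : Type*} [Fintype σ] [DecidableEq σ]

/-! ## §1 Proposition 2.33 (3) ⟹ (1), (2) at a point -/

section Pointwise

/-- **Euler's formula, bilinear form**: `xᵀ H_f(w) w = (d-1) Σ_i x_i ∂_i f(w)` for `f` homogeneous of degree `d`.
[cite: BrandenHuh2019, §2.5 proof of Prop. 2.33 ("by Euler's formula for homogeneous functions")] -/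
theorem toBilin'_hessianAt_right_self {f : MvPolynomial σ ℝ} {d : ℕ} (hf : f.IsHomogeneous d) (w x : σ → ℝ) :
    Matrix.toBilin' (hessianAt f w) x w = ((d - 1 : ℕ) : ℝ) * ∑ i, x i * eval w (pderiv i f) := by
  rw [toBilin'_hessianAt_apply, Finset.mul_sum]
  refine Finset.sum_congr rfl fun i _ ↦ ?_
  have h : ∑ j, hessianAt f w i j * x i * w j = x i * ∑ j, hessianAt f w i j * w j := by
    rw [Finset.mul_sum]
    exact Finset.sum_congr rfl fun j _ ↦ by ring
  rw [h, sum_hessianAt_mul hf w i]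
  ring

/-- **Proposition 2.33, (3) ⟹ (1), pointwise and polarised**: let `f` be homogeneous of degree `d ≥ 2` with nonnegative
coefficients, `w ∈ ℝ^n_{≥0}`, and suppose `H_f(w)` has at most one positive eigenvalue. Then
`f(w) · xᵀ H_f(w) x ≤ (1 - 1/d) (Σ_i x_i ∂_i f(w))²` for every `x ∈ ℝ^n` — i.e. the Hessian
`(1/d) f^{1/d-2} (f H_f - (1 - 1/d) ∇f ∇fᵀ)` of `f^{1/d}` is negative semidefinite at `w` (when `f(w) > 0`). Proof:
reverse Cauchy–Schwarz `(xᵀHx)(wᵀHw) ≤ (xᵀHw)²` with Euler's `wᵀHw = d(d-1) f(w)`, `Hw = (d-1)∇f(w)`.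
[cite: BrandenHuh2019, §2.5 Prop. 2.33 ((3) ⟹ (1)); §2.3 Prop. 2.17 (the same computation for `x = e_i + t e_j`)] -/
theorem eval_mul_toBilin'_hessianAt_le {f : MvPolynomial σ ℝ} {d : ℕ} (hf : f.IsHomogeneous d) (hd : 2 ≤ d)
    (hnn : ∀ α, 0 ≤ coeff α f) {w : σ → ℝ} (hw : ∀ k, 0 ≤ w k)
    (h1 : sigPos (Matrix.toBilin' (hessianAt f w)).toQuadraticMap ≤ 1) (x : σ → ℝ) :
    eval w f * Matrix.toBilin' (hessianAt f w) x x ≤ (1 - 1 / (d : ℝ)) * (∑ i, x i * eval w (pderiv i f)) ^ 2 := by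
  have hd1 : ((d - 1 : ℕ) : ℝ) = d - 1 := by rw [Nat.cast_sub (by omega : 1 ≤ d), Nat.cast_one]
  have hdpos : (0 : ℝ) < d := by exact_mod_cast (show 0 < d by omega)
  have hd1pos : (0 : ℝ) < d - 1 := by
    have : (2 : ℝ) ≤ d := by exact_mod_cast hd
    linarith
  have hF0 : 0 ≤ eval w f := eval_nonneg_of_coeff_nonneg hnn hw
  have hww : Matrix.toBilin' (hessianAt f w) w w = d * ((d - 1 : ℕ) : ℝ) * eval w f := toBilin'_hessianAt_self hf w
  have hB := mul_le_sq_of_sigPos_le_one (Matrix.toBilin' (hessianAt f w)) (isSymm_toBilin'_hessianAt f w) h1 x w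
    (by rw [hww, hd1]; positivity)
  rw [hww, toBilin'_hessianAt_right_self hf, hd1] at hB
  set Q := Matrix.toBilin' (hessianAt f w) x x
  set g := ∑ i, x i * eval w (pderiv i f)
  -- `hB : Q · (d (d-1) f) ≤ ((d-1) g)²`; divide by `d (d-1) > 0`
  have h2 : (d : ℝ) - 1 ≠ 0 := hd1pos.ne'
  have h3 : ((d : ℝ) - 1) * ((d : ℝ) * (eval w f * Q)) ≤ ((d : ℝ) - 1) * (((d : ℝ) - 1) * g ^ 2) := by
    calc ((d : ℝ) - 1) * ((d : ℝ) * (eval w f * Q)) = Q * ((d : ℝ) * ((d : ℝ) - 1) * eval w f) := by ring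
      _ ≤ (((d : ℝ) - 1) * g) ^ 2 := hB
      _ = ((d : ℝ) - 1) * (((d : ℝ) - 1) * g ^ 2) := by ring
  have h4 : (d : ℝ) * (eval w f * Q) ≤ ((d : ℝ) - 1) * g ^ 2 := le_of_mul_le_mul_left h3 hd1pos
  rw [show (1 - 1 / (d : ℝ)) * g ^ 2 = (((d : ℝ) - 1) * g ^ 2) / d by field_simp]
  rw [le_div_iff₀ hdpos]
  linarith

/-- **Proposition 2.33, (3) ⟹ (2), pointwise**: under the same hypotheses `f(w) · xᵀ H_f(w) x ≤ (Σ_i x_i ∂_i f(w))²` —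
the Hessian `(f H_f - ∇f ∇fᵀ)/f²` of `log f` is negative semidefinite at `w`. [cite: BrandenHuh2019, §2.5 Prop. 2.33
((3) ⟹ (2), "The equivalence of (2) and (3) appears in [AOV18]")] -/
theorem eval_mul_toBilin'_hessianAt_le' {f : MvPolynomial σ ℝ} {d : ℕ} (hf : f.IsHomogeneous d) (hd : 2 ≤ d)
    (hnn : ∀ α, 0 ≤ coeff α f) {w : σ → ℝ} (hw : ∀ k, 0 ≤ w k)
    (h1 : sigPos (Matrix.toBilin' (hessianAt f w)).toQuadraticMap ≤ 1) (x : σ → ℝ) :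
    eval w f * Matrix.toBilin' (hessianAt f w) x x ≤ (∑ i, x i * eval w (pderiv i f)) ^ 2 := by
  refine (eval_mul_toBilin'_hessianAt_le hf hd hnn hw h1 x).trans ?_
  have hdpos : (0 : ℝ) < d := by exact_mod_cast (show 0 < d by omega)
  have h : 1 - 1 / (d : ℝ) ≤ 1 := by
    have : 0 ≤ 1 / (d : ℝ) := by positivity
    linarith
  exact (mul_le_mul_of_nonneg_right h (sq_nonneg _)).trans (by rw [one_mul])

end Pointwise

/-! ## §2 Lorentzian polynomials: `f^{1/d}`-concavity, log-concavity, strong and complete log-concavity -/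

section Lorentzian

omit [DecidableEq σ] in
/-- The Hessian of a form of degree `≤ 1` vanishes. [cite: BrandenHuh2019, §2.2 Def. 2.6 (`L^0_n`, `L^1_n`)] -/
theorem hessianAt_eq_zero_of_degree_le_one {f : MvPolynomial σ ℝ} {d : ℕ} (hf : f.IsHomogeneous d) (hd : d ≤ 1)
    (w : σ → ℝ) : hessianAt f w = 0 := by
  ext i j
  rw [hessianAt_apply, Matrix.zero_apply, ← iterPderiv_single_add_single,
    iterPderiv_eq_zero_of_lt hf (by rw [map_add, Finsupp.degree_single, Finsupp.degree_single]; omega), map_zero]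

/-- **Lorentzian ⟹ `f^{1/d}` concave (Hessian form)**: for `f ∈ L^d_n`, `d ≥ 2`, `w ∈ ℝ^n_{≥0}` and all `x ∈ ℝ^n`,
`f(w) · xᵀ H_f(w) x ≤ (1 - 1/d)(∇f(w)·x)²` (Thm. 2.16 (2) with Prop. 2.33 (3) ⟹ (1)). [cite: BrandenHuh2019, §2.5
Prop. 2.33, Thm. 2.30; §2.3 Thm. 2.16 (2)] -/
theorem eval_mul_toBilin'_hessianAt_le_of_mem_lorentzian {d : ℕ} {f : MvPolynomial σ ℝ} (hf : f ∈ lorentzian σ d)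
    (hd : 2 ≤ d) {w : σ → ℝ} (hw : ∀ k, 0 ≤ w k) (x : σ → ℝ) :
    eval w f * Matrix.toBilin' (hessianAt f w) x x ≤ (1 - 1 / (d : ℝ)) * (∑ i, x i * eval w (pderiv i f)) ^ 2 :=
  eval_mul_toBilin'_hessianAt_le (isHomogeneous_of_mem_lorentzian hf) hd (coeff_nonneg_of_mem_lorentzian hf) hw
    (sigPos_hessianAt_le_one_of_mem_lorentzian' hf hd hw) x

/-- **Lorentzian ⟹ log-concave on the orthant (Hessian form)**: for `f ∈ L^d_n` (any `d`), `w ∈ ℝ^n_{≥0}`, `x ∈ ℝ^n`: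
`f(w) · xᵀ H_f(w) x ≤ (∇f(w)·x)²`, i.e. `f ∇²f - ∇f ∇fᵀ ≼ 0` at `w` (for `d ≤ 1` the Hessian vanishes).
[cite: BrandenHuh2019, §2.5 Thm. 2.30 ((3) ⟹ (2) at `α = 0`), Prop. 2.33] -/
theorem logConcave_of_mem_lorentzian {d : ℕ} {f : MvPolynomial σ ℝ} (hf : f ∈ lorentzian σ d) {w : σ → ℝ}
    (hw : ∀ k, 0 ≤ w k) (x : σ → ℝ) :
    eval w f * Matrix.toBilin' (hessianAt f w) x x ≤ (∑ i, x i * eval w (pderiv i f)) ^ 2 := by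
  rcases Nat.lt_or_ge d 2 with hd | hd
  · rw [hessianAt_eq_zero_of_degree_le_one (isHomogeneous_of_mem_lorentzian hf) (by omega), map_zero,
      LinearMap.zero_apply, LinearMap.zero_apply, mul_zero]
    exact sq_nonneg _
  · exact eval_mul_toBilin'_hessianAt_le' (isHomogeneous_of_mem_lorentzian hf) hd (coeff_nonneg_of_mem_lorentzian hf) hw
      (sigPos_hessianAt_le_one_of_mem_lorentzian' hf hd hw) x

/-- **Theorem 2.30, (3) ⟹ (2) (Hessian form): a Lorentzian polynomial is strongly log-concave** — for every `α ∈ ℕ^n`,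
`g = ∂^α f` satisfies `g(w) · xᵀ H_g(w) x ≤ (∇g(w)·x)²` on `ℝ^n_{≥0}` (`∂^α f ∈ L^{d-|α|}` by Def. 2.6, or `∂^α f = 0`).
[cite: BrandenHuh2019, §2.5 Thm. 2.30 ((3) ⟹ (2), Gurvits' strong log-concavity)] -/
theorem stronglyLogConcave_of_mem_lorentzian {d : ℕ} {f : MvPolynomial σ ℝ} (hf : f ∈ lorentzian σ d) (α : σ →₀ ℕ)
    {w : σ → ℝ} (hw : ∀ k, 0 ≤ w k) (x : σ → ℝ) :
    eval w (iterPderiv α f) * Matrix.toBilin' (hessianAt (iterPderiv α f) w) x x ≤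
      (∑ i, x i * eval w (pderiv i (iterPderiv α f))) ^ 2 := by
  rcases Nat.lt_or_ge d α.degree with hlt | hle
  · rw [iterPderiv_eq_zero_of_lt (isHomogeneous_of_mem_lorentzian hf) hlt, map_zero, zero_mul]
    exact sq_nonneg _
  · obtain ⟨e, rfl⟩ : ∃ e, d = e + α.degree := ⟨d - α.degree, by omega⟩
    exact logConcave_of_mem_lorentzian (iterPderiv_mem_lorentzian hf) hw x

/-- **Theorem 2.30, (3) ⟹ (1) (Hessian form): a Lorentzian polynomial is completely log-concave** — for any list of
nonnegative vectors `a_1, …, a_m ∈ ℝ^n_{≥0}` with `m ≤ d`, `g = D_{a_1} ⋯ D_{a_m} f` (`D_a = Σ_j a_j ∂_j`) satisfies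
`g(w) · xᵀ H_g(w) x ≤ (∇g(w)·x)²` on `ℝ^n_{≥0}` (`g ∈ L^{d-m}` by Cor. 2.11). [cite: BrandenHuh2019, §2.5 Thm. 2.30
((3) ⟹ (1), Anari–Oveis Gharan–Vinzant's complete log-concavity); §2.2 Cor. 2.11] -/
theorem completelyLogConcave_of_mem_lorentzian {d : ℕ} {f : MvPolynomial σ ℝ} (l : List (σ → ℝ))
    (hl : ∀ a ∈ l, ∀ k, 0 ≤ a k) (hld : l.length ≤ d) (hf : f ∈ lorentzian σ d) {w : σ → ℝ} (hw : ∀ k, 0 ≤ w k)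
    (x : σ → ℝ) :
    eval w (l.foldr dirDeriv f) * Matrix.toBilin' (hessianAt (l.foldr dirDeriv f) w) x x ≤
      (∑ i, x i * eval w (pderiv i (l.foldr dirDeriv f))) ^ 2 := by
  obtain ⟨e, rfl⟩ : ∃ e, d = e + l.length := ⟨d - l.length, by omega⟩
  exact logConcave_of_mem_lorentzian (foldr_dirDeriv_mem_lorentzian l hl hf) hw x

/-- The `f^{1/d}` form for derivatives: for `f ∈ L^d_n` and `|α| ≤ d - 2`, `g = ∂^α f ∈ L^{d-|α|}` satisfies
`g(w) · xᵀ H_g(w) x ≤ (1 - 1/(d-|α|))(∇g(w)·x)²` on `ℝ^n_{≥0}`. [cite: BrandenHuh2019, §2.5 Prop. 2.33 ((3) ⟹ (1)) with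
§2.2 Def. 2.6] -/
theorem eval_iterPderiv_mul_toBilin'_hessianAt_le {d : ℕ} {f : MvPolynomial σ ℝ} (hf : f ∈ lorentzian σ d) {α : σ →₀ ℕ}
    {e : ℕ} (he : d = e + α.degree) (he2 : 2 ≤ e) {w : σ → ℝ} (hw : ∀ k, 0 ≤ w k) (x : σ → ℝ) :
    eval w (iterPderiv α f) * Matrix.toBilin' (hessianAt (iterPderiv α f) w) x x ≤
      (1 - 1 / (e : ℝ)) * (∑ i, x i * eval w (pderiv i (iterPderiv α f))) ^ 2 := by
  subst he
  exact eval_mul_toBilin'_hessianAt_le_of_mem_lorentzian (iterPderiv_mem_lorentzian hf) he2 hw x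

end Lorentzian

end Literature.Combinatorics.LorentzianPolynomials

end
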